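import Summits.QuantumFields.BalabanUV.Beta.GAN24.ConvCKOfShapes

/-!
# `BalabanUV.Beta.GAN24.FibreContinuity` — binder row G-an2-4 / (CONV-C), road P1-fibre, typer row P1-Y09c (node N14c):
# CONTINUITY GLUE — the inverse-fibre entries, `kFibW`, `kFib`, `kFibΔ` are CONTINUOUS at real momenta, and a bound proved on the
# PUNCTURED zone `BZ ∖ {0}` holds on all of `BZ`; so rows L09 / L11 need the closed form on `BZ ∖ {0}` only

NOT IN PRINT; OUR PROOF ATTEMPT.  HONEST FRAMING (cell contract, verbatim): «discharging `BetaPertH` makes Bałaban's UV stability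
UNCONDITIONAL — a real constructive-QFT result; it is NOT the continuum limit and NOT the Clay problem.»  HONEST DEPENDENCY (verbatim):
«continuum YM on T⁴ ⇐ BetaPertH ∧ nine spine estimates (0/9 proved); BetaPertH ⇐ (D1) ∧ (D4) ∧ CAP+tail; G-an2-4 gates asym, D1 and
NE2/3/4.»  [folklore] point-set topology over the cell's own typed objects (`CombesThomasFibre.fibInv`, `CombesThomasFibreStep.kFibW/kFib/kFibΔ`,
lit2's `FibreInverseDecay.trigPolySymbol/cphase`, an2's `BlochFibreMatrix.det_trigPolySymbol_ne_zero`): Cramer's rule `A⁻¹ = det⁻¹ · adj`,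
continuity of determinants / adjugates / finite sums, and ONE sequence `s_n = (π/(n+1), …, π/(n+1)) → 0` inside `BZ ∖ {0}`.  It cites nothing,
mints no fact (`def … : Prop` count: 0), instantiates NO wall binder, proves NO estimate.  NOT summit progress; NOT BetaPertH, NOT continuum, NOT Clay.

## Why (typer LEAVES.md v2.2, row P1-Y09c; consumers p1 rows L09 `FibreUniformBound` / L11 `FibreRate`)
The closed form of the fibre function (`AliasObjects.kFibClosed`, row L05b) is an identity on the REGULAR real zone `{p ∈ BZ | p ≠ 0}` (at `p = 0`
the `m = 0` block symbol `L_0 = lapSym 0 = 0` is singular and the executable spec `kmat_closed` switches to an else-branch).  The targets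
of L09 (`∀ p ∈ BZ, ‖kFib … (ofRealVec p)‖ ≤ C`) and L11 (`RealRateK`: `∀ p ∈ BZ, ‖kFib_{j+1} − kFib_j‖ ≤ c θ^j`) quantify over ALL of `BZ`.
Since `p ↦ kFib … (ofRealVec p)` is continuous on `ℝ^{d+1}` (the Bloch fibre matrix is non-singular at EVERY real momentum, an2's
`det_trigPolySymbol_ne_zero`, so its inverse entries are `det⁻¹ · adjugate` of a trigonometric polynomial), a bound on `BZ ∖ {0}` extends to `BZ`
(§3).  Consequence recorded for gan24-p1: the `p = 0` else-branch of `kmat_closed` and L05(b)'s «p = 0 variant» are NOT needed on road P1.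

## Contents (all [folklore]; `N ≥ 1` block side, lattice `ℤ^{d+1}`, `BZ (d+1) = [−π,π]^{d+1}` = `B4ContourShift.BZ` BY NAME)
§1 `continuous_trigPolySymbol` (matrix-valued), `continuous_trigPolySymbol_inv_apply_ofRealVec` (generic: det ≠ 0 at every real momentum ⇒
   each entry of `s ↦ (A (ofRealVec s))⁻¹` continuous), **`continuous_fibInv_ofRealVec`**, `integrableOn_norm_fibInv` (discharges the `hint`
   hypothesis of `CombesThomasFibre.abs_KInv_le_of_fibInv_le`) and `abs_KInv_le_of_fibInv_le'` (that theorem WITHOUT `hint`).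
§2 `continuous_cphase_ofRealVec`, **`continuous_kFibW_ofRealVec`**, `continuous_kFib_ofRealVec`, `continuous_kFibΔ_ofRealVec`.
§3 THE CLOSURE LEMMA **`norm_le_on_BZ_of_punctured`** (`ContinuousAt f 0`, `‖f s‖ ≤ C` on `BZ ∖ {0}` ⇒ on `BZ`; the diagonal sequence
   `s_n = (π/(n+1), …)` lives inside the proof), `norm_le_on_BZ_of_punctured'` (`Continuous f`), `norm_sub_le_on_BZ_of_punctured` (two-function form).
§4 CONSEQUENCES IN THE LOCATED CURRENCIES: `kFib_bound_of_punctured` (L09's target from its punctured form), `kFib_rate_of_punctured`,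
   **`realRateK_of_punctured`** (`ConvCKOfShapes.RealRateK d Lc c θ` from the punctured rate), `supRateK_of_kFib_punctured`
   (`CombesThomas.SupRateK` from the punctured rate, via `supRateK_of_kFib` BY NAME), and the TRANSFER forms through an arbitrary closed
   form `G` agreeing with `kFib` on `BZ ∖ {0}` (row L05b's `AliasObjects.kFibClosed`): `kFib_bound_of_eqOn_punctured`, `realRateK_of_eqOn_punctured`.
-/

noncomputable section

open Complex MeasureTheory Finset Filter Topology
open scoped BigOperators
open Literature.MathematicalPhysics.QuantumFieldTheory
open Literature.MathematicalPhysics.QuantumFieldTheory.Balaban1983to89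
open Literature.MathematicalPhysics.QuantumFieldTheory.Balaban1983to89.Beta
open B4Strip (ofRealVec)
open B4ContourShift (BZ continuous_ofRealVec)
open BlochFibreMatrix (Idx stencil pieceMatrix det_trigPolySymbol_ne_zero)
open FibreInverseDecay (cphase continuous_cphase trigPolySymbol inv_apply_eq isCompact_BZ)
open OneStepResolventKernel (Fib KInv)
open Summit.QuantumFields.BalabanUV.Beta.GAN24.CombesThomas (SupRateK sfStep smStep)
open Summit.QuantumFields.BalabanUV.Beta.GAN24.CombesThomasFibre (fibInv legIdx abs_KInv_le_of_fibInv_le)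
open Summit.QuantumFields.BalabanUV.Beta.GAN24.CombesThomasFibreStep (kFibW kFib kFibΔ supRateK_of_kFib)
open Summit.QuantumFields.BalabanUV.Beta.GAN24.ConvCKOfShapes (RealRateK)

namespace Summit.QuantumFields.BalabanUV.Beta.GAN24.FibreContinuity

variable {d : ℕ}

/-! ## §1 Continuity of the fibre symbol and of the inverse-fibre entries at real momenta -/

section Symbol

variable {n : Type*}

/-- [folklore] A trigonometric-polynomial matrix multiplier `p ↦ Σ_{a ∈ S} e^{ip·a} L_a` is continuous (matrix-valued, on all of `ℂ^{d+1}`). -/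
theorem continuous_trigPolySymbol (S : Finset (Fin (d + 1) → ℤ)) (L : (Fin (d + 1) → ℤ) → Matrix n n ℂ) :
    Continuous (fun p : Fin (d + 1) → ℂ => trigPolySymbol S L p) := by
  unfold trigPolySymbol
  exact continuous_finsetSum S fun a _ => (continuous_cphase a).smul continuous_const

variable [Fintype n] [DecidableEq n]

/-- [folklore] CRAMER: if the multiplier is non-singular at EVERY real momentum, each entry of `s ↦ (A (ofRealVec s))⁻¹` is continuous on
`ℝ^{d+1}` (`A⁻¹ = det⁻¹ · adj`, `FibreInverseDecay.inv_apply_eq`; determinant and adjugate are polynomial in the entries). -/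
theorem continuous_trigPolySymbol_inv_apply_ofRealVec (S : Finset (Fin (d + 1) → ℤ)) (L : (Fin (d + 1) → ℤ) → Matrix n n ℂ)
    (hdet : ∀ s : Fin (d + 1) → ℝ, (trigPolySymbol S L (ofRealVec s)).det ≠ 0) (i j : n) :
    Continuous (fun s : Fin (d + 1) → ℝ => (trigPolySymbol S L (ofRealVec s))⁻¹ i j) := by
  have hA : Continuous (fun s : Fin (d + 1) → ℝ => trigPolySymbol S L (ofRealVec s)) :=
    (continuous_trigPolySymbol S L).comp continuous_ofRealVec
  have h : (fun s : Fin (d + 1) → ℝ => (trigPolySymbol S L (ofRealVec s))⁻¹ i j) =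
      fun s => ((trigPolySymbol S L (ofRealVec s)).det)⁻¹ * (trigPolySymbol S L (ofRealVec s)).adjugate i j := by
    funext s
    exact inv_apply_eq _ i j
  rw [h]
  exact (hA.matrix_det.inv₀ hdet).mul (hA.matrix_adjugate.matrix_elem i j)

end Symbol

section Fibre

variable {N : ℕ} [NeZero N]

/-- [folklore] **THE INVERSE-FIBRE ENTRY FUNCTIONS ARE CONTINUOUS AT REAL MOMENTA**: for every block side `N ≥ 1` and box indices `i, j`,
`s ↦ fibInv N i j (ofRealVec s) = ((F_N(s))⁻¹)_{ij}` is continuous on all of `ℝ^{d+1}` (incl. `s = 0`), because the Bloch fibre matrix of the typed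
KKT block system is non-singular at every real momentum (an2's `BlochFibreMatrix.det_trigPolySymbol_ne_zero`). -/
theorem continuous_fibInv_ofRealVec (i j : Idx (d + 1) N) :
    Continuous (fun s : Fin (d + 1) → ℝ => fibInv N i j (ofRealVec s)) :=
  continuous_trigPolySymbol_inv_apply_ofRealVec (stencil (d + 1)) (pieceMatrix (N := N))
    (fun s => det_trigPolySymbol_ne_zero s) i j

/-- [folklore] Hence the real-zone norm of an inverse-fibre entry is integrable on the (compact) zone — the `hint` hypothesis of
`CombesThomasFibre.abs_KInv_le_of_fibInv_le`, discharged once and for all. -/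
theorem integrableOn_norm_fibInv (i j : Idx (d + 1) N) :
    IntegrableOn (fun p : Fin (d + 1) → ℝ => ‖fibInv N i j (ofRealVec p)‖) (BZ (d + 1)) :=
  (continuous_fibInv_ofRealVec i j).norm.continuousOn.integrableOn_compact (isCompact_BZ (d + 1))

/-- [folklore] `CombesThomasFibre.abs_KInv_le_of_fibInv_le` WITHOUT its integrability hypothesis: a real-zone entrywise bound
`‖fibInv N (legIdx a x) (legIdx b y) (ofRealVec p)‖ ≤ ε` (all `p ∈ BZ`) gives `|KInv N x y a b| ≤ ε`. -/
theorem abs_KInv_le_of_fibInv_le' (x y : Fin (d + 1) → ℤ) (a b : Fib d) {ε : ℝ} (hε : 0 ≤ ε)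
    (hF : ∀ p ∈ BZ (d + 1), ‖fibInv N (legIdx N a x) (legIdx N b y) (ofRealVec p)‖ ≤ ε) :
    |KInv (N := N) x y a b| ≤ ε :=
  abs_KInv_le_of_fibInv_le x y a b hε (integrableOn_norm_fibInv _ _) hF

end Fibre

/-! ## §2 Continuity of the phase-dressed leg sums `kFibW`, `kFib`, `kFibΔ` at real momenta -/

section LegSums

/-- [folklore] The Bloch character is continuous at real momenta: `s ↦ cphase q (ofRealVec s)`. -/
theorem continuous_cphase_ofRealVec (q : Fin (d + 1) → ℤ) :
    Continuous (fun s : Fin (d + 1) → ℝ => cphase q (ofRealVec s)) :=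
  (continuous_cphase q).comp continuous_ofRealVec

variable {N : ℕ} [NeZero N]

/-- [folklore] **`kFibW` IS CONTINUOUS AT REAL MOMENTA**: the phase-dressed, leg-averaged, unit-scaled fibre function (an explicit finite sum of
`const · cphase · fibInv`) composed with `ofRealVec` is continuous on `ℝ^{d+1}`, for every decimation factor `M`, units `(s_f, s_m)` and legs. -/
theorem continuous_kFibW_ofRealVec (M : ℕ) (sf sm : ℝ) (a : Fib d) (x' : Fin (d + 1) → ℤ) (b : Fib d) (y' : Fin (d + 1) → ℤ) :
    Continuous (fun s : Fin (d + 1) → ℝ => kFibW N M sf sm a x' b y' (ofRealVec s)) := by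
  unfold kFibW
  refine continuous_finsetSum _ fun ii _ => ?_
  exact continuous_const.mul ((continuous_cphase_ofRealVec _).mul (continuous_fibInv_ofRealVec _ _))

variable {Lc : ℕ} [NeZero Lc]

/-- [folklore] **`kFib` IS CONTINUOUS AT REAL MOMENTA** (`kFib Lc s_f s_m j = kFibW (Lc^(j+1)) (Lc^j) (s_f j) (s_m j)`), for every step `j`. -/
theorem continuous_kFib_ofRealVec (sf sm : ℕ → ℝ) (j : ℕ) (a : Fib d) (x' : Fin (d + 1) → ℤ) (b : Fib d) (y' : Fin (d + 1) → ℤ) :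
    Continuous (fun s : Fin (d + 1) → ℝ => kFib Lc sf sm j a x' b y' (ofRealVec s)) := by
  unfold kFib
  exact continuous_kFibW_ofRealVec _ _ _ _ _ _ _

/-- [folklore] `kFibΔ` (the same sum with re-based phases) is continuous at real momenta. -/
theorem continuous_kFibΔ_ofRealVec (sf sm : ℕ → ℝ) (j : ℕ) (a : Fib d) (x' : Fin (d + 1) → ℤ) (b : Fib d) (y' : Fin (d + 1) → ℤ) :
    Continuous (fun s : Fin (d + 1) → ℝ => kFibΔ Lc sf sm j a x' b y' (ofRealVec s)) := by
  unfold kFibΔ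
  exact (continuous_cphase_ofRealVec _).mul (continuous_kFib_ofRealVec _ _ _ _ _ _ _)

end LegSums

/-! ## §3 The closure lemma: a bound on the punctured zone `BZ ∖ {0}` holds on `BZ` -/

section Closure

/-- [folklore] **THE CLOSURE LEMMA**: a function continuous at `0` and bounded in norm by `C` on the PUNCTURED zone `BZ ∖ {0}` is bounded by `C`
on all of `BZ`.  Proof: the diagonal sequence `s_n = (π/(n+1), …, π/(n+1))` lies in `BZ ∖ {0}` and tends to `0`, so `‖f 0‖ = lim ‖f s_n‖ ≤ C`
(`le_of_tendsto'`).  Valued in any seminormed group (scalars `ℂ`, differences, vectors). -/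
theorem norm_le_on_BZ_of_punctured {E : Type*} [SeminormedAddCommGroup E] {f : (Fin (d + 1) → ℝ) → E} {C : ℝ}
    (hf : ContinuousAt f 0) (hb : ∀ s ∈ BZ (d + 1), s ≠ 0 → ‖f s‖ ≤ C) : ∀ s ∈ BZ (d + 1), ‖f s‖ ≤ C := by
  intro s hs
  by_cases h0 : s = 0
  · subst h0
    -- the diagonal sequence `s_n = (π/(n+1), …, π/(n+1))`
    set e : ℕ → (Fin (d + 1) → ℝ) := fun n _ => Real.pi / ((n : ℝ) + 1) with he
    have hmem : ∀ n, e n ∈ BZ (d + 1) := by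
      intro n
      have hn : (1 : ℝ) ≤ (n : ℝ) + 1 := by
        have : (0 : ℝ) ≤ n := Nat.cast_nonneg n
        linarith
      have h1 : Real.pi / ((n : ℝ) + 1) ≤ Real.pi := div_le_self Real.pi_pos.le hn
      have h2 : 0 ≤ Real.pi / ((n : ℝ) + 1) := div_nonneg Real.pi_pos.le (by linarith)
      refine Set.mem_Icc.2 ⟨fun _ => ?_, fun _ => ?_⟩
      · show -Real.pi ≤ Real.pi / ((n : ℝ) + 1)
        linarith [Real.pi_pos]
      · exact h1
    have hne : ∀ n, e n ≠ 0 := by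
      intro n h
      have h0 := congr_fun h 0
      have hpos : (0 : ℝ) < Real.pi / ((n : ℝ) + 1) := div_pos Real.pi_pos (by positivity)
      simp only [he, Pi.zero_apply] at h0
      exact hpos.ne' h0
    have htend : Tendsto e atTop (𝓝 0) := by
      refine tendsto_pi_nhds.2 fun _ => ?_
      have h := (tendsto_one_div_add_atTop_nhds_zero_nat).const_mul Real.pi
      rw [mul_zero] at h
      refine h.congr fun n => ?_
      simp only [he]
      ring
    have hlim : Tendsto (fun n => ‖f (e n)‖) atTop (𝓝 ‖f 0‖) :=
      (continuous_norm.continuousAt.tendsto.comp hf.tendsto).comp htend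
    exact le_of_tendsto' hlim fun n => hb _ (hmem n) (hne n)
  · exact hb s hs h0

/-- [folklore] The same for an everywhere-continuous `f` (the form the fibre functions come in, §2). -/
theorem norm_le_on_BZ_of_punctured' {E : Type*} [SeminormedAddCommGroup E] {f : (Fin (d + 1) → ℝ) → E} {C : ℝ}
    (hf : Continuous f) (hb : ∀ s ∈ BZ (d + 1), s ≠ 0 → ‖f s‖ ≤ C) : ∀ s ∈ BZ (d + 1), ‖f s‖ ≤ C :=
  norm_le_on_BZ_of_punctured hf.continuousAt hb

/-- [folklore] TWO-FUNCTION FORM: `‖f − g‖ ≤ c` on `BZ ∖ {0}` for continuous `f, g` gives `‖f − g‖ ≤ c` on `BZ`. -/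
theorem norm_sub_le_on_BZ_of_punctured {E : Type*} [SeminormedAddCommGroup E] {f g : (Fin (d + 1) → ℝ) → E} {c : ℝ}
    (hf : Continuous f) (hg : Continuous g) (hb : ∀ s ∈ BZ (d + 1), s ≠ 0 → ‖f s - g s‖ ≤ c) :
    ∀ s ∈ BZ (d + 1), ‖f s - g s‖ ≤ c :=
  norm_le_on_BZ_of_punctured' (f := fun s => f s - g s) (hf.sub hg) hb

end Closure

/-! ## §4 Consequences in the located currencies (L09's uniform bound, L11's `RealRateK`, `SupRateK`) -/

section Located

variable {Lc : ℕ} [NeZero Lc]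

/-- [folklore] **L09's TARGET FROM ITS PUNCTURED FORM**: a `j`-uniform real-zone bound of the fibre functions proved for `p ≠ 0` holds on the
whole zone. -/
theorem kFib_bound_of_punctured (sf sm : ℕ → ℝ) {C : ℝ}
    (h : ∀ (j : ℕ) (x' y' : Fin (d + 1) → ℤ) (a b : Fib d), ∀ p ∈ BZ (d + 1), p ≠ 0 →
      ‖kFib Lc sf sm j a x' b y' (ofRealVec p)‖ ≤ C) :
    ∀ (j : ℕ) (x' y' : Fin (d + 1) → ℤ) (a b : Fib d), ∀ p ∈ BZ (d + 1), ‖kFib Lc sf sm j a x' b y' (ofRealVec p)‖ ≤ C :=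
  fun j x' y' a b => norm_le_on_BZ_of_punctured' (continuous_kFib_ofRealVec sf sm j a x' b y') (h j x' y' a b)

/-- [folklore] **L11's RATE FROM ITS PUNCTURED FORM**: a real-zone step rate `‖kFib_{j+1} − kFib_j‖ ≤ c·θ^j` proved for `p ≠ 0` holds on the
whole zone. -/
theorem kFib_rate_of_punctured (sf sm : ℕ → ℝ) {c θ : ℝ}
    (h : ∀ (j : ℕ) (x' y' : Fin (d + 1) → ℤ) (a b : Fib d), ∀ p ∈ BZ (d + 1), p ≠ 0 →
      ‖kFib Lc sf sm (j + 1) a x' b y' (ofRealVec p) - kFib Lc sf sm j a x' b y' (ofRealVec p)‖ ≤ c * θ ^ j) :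
    ∀ (j : ℕ) (x' y' : Fin (d + 1) → ℤ) (a b : Fib d), ∀ p ∈ BZ (d + 1),
      ‖kFib Lc sf sm (j + 1) a x' b y' (ofRealVec p) - kFib Lc sf sm j a x' b y' (ofRealVec p)‖ ≤ c * θ ^ j :=
  fun j x' y' a b => norm_sub_le_on_BZ_of_punctured (continuous_kFib_ofRealVec sf sm (j + 1) a x' b y')
    (continuous_kFib_ofRealVec sf sm j a x' b y') (h j x' y' a b)

/-- [folklore] **SHAPE B FROM THE PUNCTURED ZONE**: in the literal units `(sfStep Lc, smStep d Lc)`, the `j`-geometric real-zone rate proved on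
`BZ ∖ {0}` gives `ConvCKOfShapes.RealRateK d Lc c θ` (the hypothesis `hB` of `convCK_of_shapes`). -/
theorem realRateK_of_punctured {c θ : ℝ}
    (h : ∀ (j : ℕ) (x' y' : Fin (d + 1) → ℤ) (a b : Fib d), ∀ p ∈ BZ (d + 1), p ≠ 0 →
      ‖kFib Lc (sfStep Lc) (smStep d Lc) (j + 1) a x' b y' (ofRealVec p) -
        kFib Lc (sfStep Lc) (smStep d Lc) j a x' b y' (ofRealVec p)‖ ≤ c * θ ^ j) :
    RealRateK d Lc c θ :=
  kFib_rate_of_punctured (sfStep Lc) (smStep d Lc) h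

/-- [folklore] … and, for general units, the one-step sup-norm rate `CombesThomas.SupRateK d Lc s_f s_m c θ` (via `supRateK_of_kFib` BY NAME). -/
theorem supRateK_of_kFib_punctured (sf sm : ℕ → ℝ) {c θ : ℝ} (hc : 0 ≤ c) (hθ : 0 ≤ θ)
    (h : ∀ (j : ℕ) (x' y' : Fin (d + 1) → ℤ) (a b : Fib d), ∀ p ∈ BZ (d + 1), p ≠ 0 →
      ‖kFib Lc sf sm (j + 1) a x' b y' (ofRealVec p) - kFib Lc sf sm j a x' b y' (ofRealVec p)‖ ≤ c * θ ^ j) :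
    SupRateK d Lc sf sm c θ :=
  supRateK_of_kFib sf sm hc hθ (kFib_rate_of_punctured sf sm h)

/-- [folklore] **TRANSFER FORM FOR L09**: if on the punctured zone the fibre functions AGREE with some closed form `G j a x′ b y′`
(row L05b: `G := AliasObjects.kFibClosed Lc s_f s_m`, an identity valid for `p ≠ 0` only) and the closed form is bounded there by `C`,
then the fibre functions are bounded by `C` on the WHOLE zone.  `G` is arbitrary here (no import of the closed form). -/
theorem kFib_bound_of_eqOn_punctured (sf sm : ℕ → ℝ) {C : ℝ}
    (G : ℕ → Fib d → (Fin (d + 1) → ℤ) → Fib d → (Fin (d + 1) → ℤ) → (Fin (d + 1) → ℂ) → ℂ)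
    (heq : ∀ (j : ℕ) (x' y' : Fin (d + 1) → ℤ) (a b : Fib d), ∀ p ∈ BZ (d + 1), p ≠ 0 →
      kFib Lc sf sm j a x' b y' (ofRealVec p) = G j a x' b y' (ofRealVec p))
    (hG : ∀ (j : ℕ) (x' y' : Fin (d + 1) → ℤ) (a b : Fib d), ∀ p ∈ BZ (d + 1), p ≠ 0 →
      ‖G j a x' b y' (ofRealVec p)‖ ≤ C) :
    ∀ (j : ℕ) (x' y' : Fin (d + 1) → ℤ) (a b : Fib d), ∀ p ∈ BZ (d + 1), ‖kFib Lc sf sm j a x' b y' (ofRealVec p)‖ ≤ C :=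
  kFib_bound_of_punctured sf sm fun j x' y' a b p hp h0 => by
    rw [heq j x' y' a b p hp h0]
    exact hG j x' y' a b p hp h0

/-- [folklore] **TRANSFER FORM FOR L11**: if on the punctured zone the fibre functions in the literal units agree with a closed form `G` and
the closed form has the step rate `‖G_{j+1} − G_j‖ ≤ c·θ^j` there, then `ConvCKOfShapes.RealRateK d Lc c θ`. -/
theorem realRateK_of_eqOn_punctured {c θ : ℝ}
    (G : ℕ → Fib d → (Fin (d + 1) → ℤ) → Fib d → (Fin (d + 1) → ℤ) → (Fin (d + 1) → ℂ) → ℂ)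
    (heq : ∀ (j : ℕ) (x' y' : Fin (d + 1) → ℤ) (a b : Fib d), ∀ p ∈ BZ (d + 1), p ≠ 0 →
      kFib Lc (sfStep Lc) (smStep d Lc) j a x' b y' (ofRealVec p) = G j a x' b y' (ofRealVec p))
    (hG : ∀ (j : ℕ) (x' y' : Fin (d + 1) → ℤ) (a b : Fib d), ∀ p ∈ BZ (d + 1), p ≠ 0 →
      ‖G (j + 1) a x' b y' (ofRealVec p) - G j a x' b y' (ofRealVec p)‖ ≤ c * θ ^ j) :
    RealRateK d Lc c θ :=
  realRateK_of_punctured fun j x' y' a b p hp h0 => by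
    rw [heq (j + 1) x' y' a b p hp h0, heq j x' y' a b p hp h0]
    exact hG j x' y' a b p hp h0

end Located

end Summit.QuantumFields.BalabanUV.Beta.GAN24.FibreContinuity

end
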